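import Mathlib.AlgebraicGeometry.EllipticCurve.LFunction
import Mathlib.NumberTheory.NumberField.CMField
import Mathlib.NumberTheory.Padics.HeightOneSpectrum
import Mathlib.RingTheory.DedekindDomain.Ideal.Lemmas
import Mathlib.RingTheory.RamificationInertia.Inertia
import Mathlib.FieldTheory.Galois.Basic
import Literature.NumberTheory.Automorphic.GLnCuspidalSpectrum
import Literature.NumberTheory.EllipticCurves.Newforms
import Literature.NumberTheory.EllipticCurves.Isogeny
import HarnessLib

-- provenance: harness21/H21/H21/Statements/Lang/Sweep1.lean @ dc0ec66 (interim HEAD d8f2665); M5 mechanical rewrite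
/-!
# Langlands family (`lang`) — statement sweep 1
(statements **lang.S23** (partial), **lang.S24**, **lang.S28** (partial))

Family `lang` (gap inventory 2026-08-12), statement file `H21/Statements/Lang/Sweep1.lean`,
`namespace Literature.Lang`. Everything is stated on top of the accepted G19 preludes
`GLnCuspidalSpectrum` (`CuspidalAutomorphicRepGL n K μ`), `GLnAdelicStructure`
(`HasSatakeParameterAt`, `principalCongruenceLevel`), the G16 preludes `Newforms`
(`IsNewform1`, `heckeEigenvalue`, `nebentypus`) and `Isogeny` (`WeierstrassCurve.HasCM`), and
Mathlib (`WeierstrassCurve.localPolynomial`, `WeierstrassCurve.baseChange`,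
`NumberField.IsCMField`, `Rat.HeightOneSpectrum.primesEquiv`,
`IsDedekindDomain.HeightOneSpectrum.under`, `Ideal.inertiaDeg`, `IsGalois`).

The ids lang.S19, lang.S20, lang.S36 (attempt 1 of this file) are stated in
`H21/Statements/Lang/AutomorphicGLn.lean`, lang.S21 in `AutomorphicLFunctions.lean` and
lang.S22 in `JacquetLanglands.lean`; they are not restated here.

## Covered inventory ids

* **lang.S23** (Arthur–Clozel, Ann. of Math. Stud. 120 (1989), Ch. 3, Thms. 4.2 and 5.1) —
  **partial**: existence of the cyclic prime-degree base change `BC_{E/F}(π)` of a cuspidal `π`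
  on `GL_n(𝔸_F)` as a *cuspidal* automorphic representation of `GL_n(𝔸_E)` with the Satake
  relation `c(Π_w) = c(π_v)^{f(w|v)}` at almost all finite places, **in the case `ℓ = [E:F]`
  does not divide `n`** (`exists_cuspidal_baseChange_of_not_dvd`). In that case
  `π ≇ π ⊗ η_{E/F}` automatically (compare central characters: `η^n = 1` forces `ℓ ∣ n`), so
  Thm. 4.2(a) gives a cuspidal lift. *Not covered:* the case `ℓ ∣ n`, where for `π ≅ π ⊗ η`
  the lift is an isobaric sum `Π₁ ⊞ ⋯ ⊞ Π_ℓ` (not in `L²_cusp`), and the description of the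
  image (`σ`-stable cuspidal `Π`) and of the fibres `{π ⊗ ηʲ}` — missing notions: isobaric
  (non-cuspidal) automorphic representations of `GL_n(𝔸_E)` and twists `π ⊗ η` of
  `CuspidalAutomorphicRepGL` by Hecke characters (`automorphic_representation` beyond
  `L²_cusp`), and the `Gal(E/F)`-action on `L²(GL_n(E)\GL_n(𝔸_E))`.
* **lang.S24** (Newton–Thorne, Publ. IHÉS 134 (2021), part I Thm. A, part II Thm. A): for a
  non-CM newform `f ∈ S_k(Γ₁(N))`, `k ≥ 2`, and `m ≥ 1` there is a cuspidal automorphic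
  representation of `GL_{m+1}(𝔸_ℚ)` whose Satake parameters at almost all `p` are
  `{αⁱ βᵐ⁻ⁱ}` for `{α, β}` the (unitary) Satake parameters of `π_f` at `p`
  (`exists_cuspidal_symmetricPower`); local glue `IsCMForm` (Ribet's definition of CM forms).
* **lang.S28** (Allen–Calegari–Caraiani–Gee–Helm–Le Hung–Newton–Scholze–Taylor–Thorne,
  Ann. Math. 197 (2023), Thm. 1.0.1) — **partial, geometric CM excluded**: every elliptic curve
  *without geometric CM* over a CM field becomes modular over a finite CM extension
  (`exists_isCMField_isModular`); local glue `WeierstrassCurve.IsModular` (cuspidal `Π` on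
  `GL₂(𝔸_F)` with `L_v(E, T) = ∏_j (1 - q_v^{1/2} α_j T)` at almost all `v`). The CM case of
  Thm. 1.0.1 is excluded because for CM by `L ⊆ F'` the automorphic representation of `E` is
  Eisenstein, not cuspidal, so the cuspidal notion `IsModular` would be the wrong one; the
  stated theorem is a consequence of Thm. 1.0.1. *Not covered:* the second half of the
  inventory text (Thm. 6.1.1, potential automorphy of suitable regular geometric
  `ρ : Γ_F → GL_n(ℚ̄_ℓ)`): "`ρ` is automorphic" needs regular algebraic `π`, i.e. the
  attachment of an `InfinityType` to the archimedean component of a cuspidal `π`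
  (`algebraic_infinity_type`, `archimedean_gK_module`).

## Ids of the round NOT covered, with the precise missing notion

* lang.S01 (local Langlands for general `G`), lang.S10 (Fargues–Scholze): connected reductive
  groups over local fields and their smooth duals `Irr(G(F))` (`connected_reductive_group`; the
  prelude `ConnectedReductiveGroupData` is an axiomatic shell without `Irr`, parabolic induction
  or the semisimplified parameter map), desiderata (D1)–(D9).
* lang.S02, lang.S03 (Clozel / Buzzard–Gee R1–R2), lang.S27 (Harris–Lan–Taylor–Thorne, Scholze):
  "`π` is (regular, L- or C-) algebraic" — the attachment of an `InfinityType` (prelude C15) to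
  the archimedean component of a cuspidal automorphic representation
  (`algebraic_infinity_type`, needs `archimedean_gK_module`); for general `G` also
  `dual_group_L_group`-valued Galois representations. The Galois side exists (trunk G10).
* lang.S04 (functoriality), lang.S05 and lang.S25 (Arthur's multiplicity formula / endoscopic
  classification), lang.S26 (trace formula): automorphic representations of a general `G(𝔸_F)`
  with L-homomorphisms `ᴸH → ᴸG`, Arthur parameters, `S_ψ`, `ε_ψ`, endoscopic transfer, the
  distributions `I_geom`, `I_spec` (`arthur_parameters`, `endoscopy_transfer`, `trace_formula`,
  `automorphic_L_function` for general `r`).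
* lang.S12, lang.S13 (definitions): connected reductive group schemes, quasi-split/inner forms
  via `H¹(k, G_ad)`, based root data ↔ reductive groups (Chevalley), pinned dual group
  (`connected_reductive_group`, `root_datum`; Mathlib has `RootPairing` but no reductive group
  schemes).
* lang.S18 (definition of automorphic forms): smooth, `K`-finite, `𝔷(𝔤)`-finite functions of
  moderate growth on `G(F)\G(𝔸_F)` and `(𝔤, K_∞) × G(𝔸_F^∞)`-subquotients (`automorphic_form`,
  `archimedean_gK_module`; only the `L²`-spectrum exists in the prelude).

## Design choices

* Automorphic measures are quantified (`∀ μ [IsAutomorphicMeasure μ]` in hypotheses,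
  `∃ μ, IsAutomorphicMeasure μ ∧ …` in conclusions), exactly as the prelude does; the measure is
  unique up to a positive scalar (`isAutomorphicMeasure_unique_smul`).
* Satake-parameter descriptions of lifts use `HasSatakeParameterAt` at one principal
  congruence level `K(𝔫)`, `𝔫 ≠ 0`, chosen once for the lift ("`Π` has level `𝔫`"), at the
  cofinitely many places `v ∤ 𝔫` (there `K(𝔫)` is `GL_n(𝒪_v)`,
  `isMaximalAt_principalCongruenceLevel`). By strong multiplicity one this pins the lift down,
  so the statements are equivalent to the printed "`Sym^m π_f` (resp. `π_E`, `BC(π)`) is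
  cuspidal automorphic". Normalisations: `Π ≤ L²(GL_n(𝔸) ⧸ A_G GL_n(K))` is unitary, so its
  Satake parameters are the unitary ones: `α + β = a_p p^{-(k-1)/2}`, `α β = χ(p)` for `π_f`;
  `L_v(E, T) = 1 - a_v T + q_v T² = ∏ (1 - q_v^{1/2} α_j T)` for `π_E`; `c(Π_w) = c(π_v)^f`
  for base change (restriction of the unramified parameter to `W_{E_w}`, `Frob_w = Frob_v^f`).
* `ℕ`-subtraction `m - i` in the symmetric-power multiset only occurs for `i ∈ range (m + 1)`.
* No new instances, no `sorry` outside proofs.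

## References

* J. Arthur, L. Clozel, *Simple algebras, base change, and the advanced theory of the trace
  formula*, Ann. of Math. Stud. 120 (1989), Ch. 3, Thms. 4.2, 5.1.
* J. Newton, J. Thorne, *Symmetric power functoriality for holomorphic modular forms I, II*,
  Publ. Math. IHÉS 134 (2021).
* K. Ribet, *Galois representations attached to eigenforms with Nebentypus*, LNM 601 (1977), §3.
* P. Allen et al., *Potential automorphy over CM fields*, Ann. of Math. 197 (2023), Thm. 1.0.1.
-/

noncomputable section

open scoped MatrixGroups Polynomial
open NumberField IsDedekindDomain MeasureTheory Filter

namespace Literature.NumberTheory.Automorphic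


/-! ### lang.S23: cyclic base change of prime degree for `GL_n` (case `ℓ ∤ n`) -/

section BaseChange

variable {n : ℕ} {F E : Type} [Field F] [NumberField F] [Field E] [NumberField E] [Algebra F E]

/-- **lang.S23** (Arthur–Clozel, *Simple algebras, base change, and the advanced theory of the
trace formula*, Ann. of Math. Stud. 120 (1989), Ch. 3, Thm. 4.2 (a) with Thm. 5.1; Langlands,
*Base change for `GL(2)`* (1980) for `n = 2`), **partial: existence of the cuspidal base change
when `ℓ ∤ n`**. Let `E / F` be a cyclic extension of number fields of prime degree `ℓ`
(`IsGalois` of prime degree; a group of prime order is cyclic) with `ℓ ∤ n`, and let `π` be a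
cuspidal automorphic representation of `GL_n(𝔸_F)`. Then there is a cuspidal automorphic
representation `Π = BC_{E/F}(π)` of `GL_n(𝔸_E)` and levels `𝔫 ⊆ 𝓞 F`, `𝔑 ⊆ 𝓞 E` such that
for all but finitely many finite places `w` of `E`, with `v = w ∩ 𝓞 F` the place below
(`HeightOneSpectrum.under`) and `f = f(w | v)` the residue degree (`Ideal.inertiaDeg`), `π` has
a Satake parameter `α = c(π_v)` at `v` and `Π` has Satake parameter `c(Π_w) = αᶠ = {aᶠ : a ∈ α}`
at `w` (the unramified base change: the Langlands class of `Π_w` is `c(π_v)^f`). Since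
`ℓ ∤ n`, `π ≇ π ⊗ η_{E/F}` (central characters), so Arthur–Clozel's lift is cuspidal; the case
`ℓ ∣ n` and the image/fibre description are not covered (module docstring).
[cite: ArthurClozelAMS120, Ch. 3, Thm. 4.2(a) and Thm. 5.1] -/
def exists_cuspidal_baseChange_of_not_dvd : Prop :=
  ∀ [IsGalois F E] (hℓ : (Module.finrank F E).Prime) (hn : ¬ Module.finrank F E ∣ n)
    (μ : Measure (AdelicGroupData.gl n F).automorphicQuotient)
    [(AdelicGroupData.gl n F).IsAutomorphicMeasure μ] (P : CuspidalAutomorphicRepGL n F μ),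
    ∃ (ν : Measure (AdelicGroupData.gl n E).automorphicQuotient)
      (_ : (AdelicGroupData.gl n E).IsAutomorphicMeasure ν) (Q : CuspidalAutomorphicRepGL n E ν)
      (𝔫 : Ideal (𝓞 F)) (_ : 𝔫 ≠ 0) (𝔑 : Ideal (𝓞 E)) (_ : 𝔑 ≠ 0),
      ∀ᶠ w : HeightOneSpectrum (𝓞 E) in cofinite,
        ¬ (w.under (𝓞 F)).asIdeal ∣ 𝔫 ∧ ¬ w.asIdeal ∣ 𝔑 ∧
          ∃ (ϖ : ((w.under (𝓞 F)).adicCompletion F)ˣ) (ϖ' : (w.adicCompletion E)ˣ)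
            (α : Multiset ℂ),
            HasSatakeParameterAt P.1 (principalCongruenceLevel n F 𝔫) (w.under (𝓞 F)) ϖ α ∧
              HasSatakeParameterAt Q.1 (principalCongruenceLevel n E 𝔑) w ϖ'
                (α.map fun a => a ^ w.asIdeal.inertiaDeg (𝓞 F))

end BaseChange

/-! ### lang.S28: potential modularity of elliptic curves over CM fields -/

section PotentialModularity

/-- The Weierstrass curve `W / F` over the number field `F` is **modular**: there are a
cuspidal automorphic representation `Π` of `GL₂(𝔸_F)` (in `L²_cusp`, for some — equivalently
any — automorphic measure) and a level `𝔫 ≠ 0` such that for all but finitely many finite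
places `v` (all with `v ∤ 𝔫`), `Π` has a Satake parameter `α_v = {α₁, α₂}` at `v` with respect
to `K(𝔫)` with `L_v(E, T) = (1 - q_v^{1/2} α₁ T)(1 - q_v^{1/2} α₂ T)`, where
`L_v(E, T) = 1 - a_v T + q_v T²` is Mathlib's `WeierstrassCurve.localPolynomial` of `E / F_v`;
i.e. `α₁ + α₂ = a_v q_v^{-1/2}`, `α₁ α₂ = 1`, i.e. `L(E, s) = L(s - 1/2, Π)` up to finitely many
Euler factors. By strong multiplicity one `Π` is unique. Like Mathlib's
`WeierstrassCurve.LFunction` this is defined for every Weierstrass curve, without an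
`IsElliptic` hypothesis; for singular `W` it is a junk notion. Refs: Allen et al., Ann. Math.
197 (2023), introduction to Thm. 1.0.1; Gelbart, *Automorphic forms on adele groups*, §7;
Diamond–Shurman, Thm. 8.8.1 (`F = ℚ`). Local glue for **lang.S28**; deliberate dot-notation
extension of Mathlib's `WeierstrassCurve` namespace. [folklore] -/
def _root_.WeierstrassCurve.IsModular {F : Type} [Field F] [NumberField F]
    (W : WeierstrassCurve F) : Prop :=
  ∃ (μ : Measure (AdelicGroupData.gl 2 F).automorphicQuotient)
    (_ : (AdelicGroupData.gl 2 F).IsAutomorphicMeasure μ) (P : CuspidalAutomorphicRepGL 2 F μ)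
    (𝔫 : Ideal (𝓞 F)) (_ : 𝔫 ≠ 0),
    ∀ᶠ v : HeightOneSpectrum (𝓞 F) in cofinite,
      ¬ v.asIdeal ∣ 𝔫 ∧ ∃ (ϖ : (v.adicCompletion F)ˣ) (α : Multiset ℂ),
        HasSatakeParameterAt P.1 (principalCongruenceLevel 2 F 𝔫) v ϖ α ∧
          (WeierstrassCurve.localPolynomial (v.adicCompletionIntegers F)
              (W.baseChange (v.adicCompletion F))).map (Int.castRingHom ℂ) =
            (α.map fun a => (1 : ℂ[X]) -
              Polynomial.C (((Real.sqrt (v.residueCard : ℝ) : ℝ) : ℂ) * a) * Polynomial.X).prod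

/-- **lang.S28** (Allen–Calegari–Caraiani–Gee–Helm–Le Hung–Newton–Scholze–Taylor–Thorne,
*Potential automorphy over CM fields*, Ann. of Math. 197 (2023), Thm. 1.0.1), **partial:
elliptic curves with geometric CM excluded, and only the elliptic-curve half of the inventory
text**. Every elliptic curve `E` without geometric complex multiplication (`¬ W.HasCM`,
prelude `Isogeny`) over a CM number field `F` (Mathlib `NumberField.IsCMField`) is
**potentially modular**: there is a finite extension `F' / F` which is again a CM field such
that `E ×_F F'` (`W.baseChange F'`) is modular (`WeierstrassCurve.IsModular`: cuspidal `Π` on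
`GL₂(𝔸_{F'})` with matching Satake parameters at almost all places). (`F'` may moreover be
taken Galois over `F`; not asserted. CM curves are modular by automorphic induction from Hecke
characters, but for CM defined over the base the automorphic representation is not cuspidal,
whence the restriction.) The potential automorphy of regular geometric `ρ` (Thm. 6.1.1) is not
covered (module docstring).
[cite: AllenCalegariCaraianiGeeEtAl2023, Thm. 1.0.1 (non-CM elliptic-curve case)] -/
def exists_isCMField_isModular : Prop :=
  ∀ {F : Type} [Field F] [NumberField F] [IsCMField F] (W : WeierstrassCurve F) [W.IsElliptic]
    (hW : ¬ W.HasCM),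
    ∃ (F' : Type) (_ : Field F') (_ : NumberField F') (_ : Algebra F F'),
      IsCMField F' ∧ (W.baseChange F').IsModular

end PotentialModularity

/-! ### lang.S24: symmetric power functoriality for non-CM newforms -/

section SymmetricPower

open EllipticCurves.ModularForms

variable {N : ℕ} [NeZero N] {k : ℤ}

/-- The eigenform `f ∈ S_k(Γ₁(N))` **is a CM form** (has complex multiplication in the sense
of Ribet, LNM 601 (1977), §3, Definition; Serre): there is a non-trivial Dirichlet character
`η` with `η(p) a_p(f) = a_p(f)` for all but finitely many primes `p` (equivalently `a_p(f) = 0`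
whenever `η(p) ≠ 1`; then `η` is the odd quadratic character of an imaginary quadratic field
by which `f` has CM). Local glue for **lang.S24**; its natural home is the G16 prelude
`Literature.Prelude.EllArithM.Newforms` (flag for the architect). Named `IsCMForm` to avoid confusion
with the geometric notion `WeierstrassCurve.HasCM` of the prelude `Isogeny`. [folklore] -/
def IsCMForm (f : CuspForm (CongruenceSubgroup.Gamma1 N) k) : Prop :=
  ∃ (M : ℕ) (η : DirichletCharacter ℂ M), η ≠ 1 ∧
    ∀ᶠ p : ℕ in cofinite, p.Prime → η p * heckeEigenvalue f p = heckeEigenvalue f p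

/-- **lang.S24** (Newton–Thorne, *Symmetric power functoriality for holomorphic modular forms*,
Publ. Math. IHÉS 134 (2021), part I Thm. A, part II Thm. A). Let `f ∈ S_k(Γ₁(N))`, `k ≥ 2`, be
a newform without complex multiplication and `m ≥ 1`. Then **`Sym^m π_f` is cuspidal
automorphic**: there are a cuspidal automorphic representation `Π` of `GL_{m+1}(𝔸_ℚ)` and a
level `𝔫 ≠ 0` such that for all but finitely many primes `p` (finite places `v ∤ 𝔫` of `ℚ`,
identified with primes by Mathlib's `Rat.HeightOneSpectrum.primesEquiv`), writing `{α, β}` for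
the unitary Satake parameters of `π_f` at `p` — `α + β = a_p(f) p^{-(k-1)/2}`, `α β = χ_f(p)`
with `χ_f` the nebentypus — `Π` has Satake parameter `{αⁱ βᵐ⁻ⁱ : 0 ≤ i ≤ m}` at `p` with
respect to `K(𝔫)`. By strong multiplicity one this characterises `Sym^m π_f`.
[cite: NewtonThorneIHES2021b, Thm. A (with part I = NewtonThorneIHES2021a, Thm. A)] -/
def exists_cuspidal_symmetricPower : Prop :=
  ∀ (hk : 2 ≤ k) {f : CuspForm (CongruenceSubgroup.Gamma1 N) k} (hf : IsNewform1 f)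
    (hCM : ¬ IsCMForm f) {m : ℕ} (hm : 1 ≤ m),
    ∃ (μ : Measure (AdelicGroupData.gl (m + 1) ℚ).automorphicQuotient)
      (_ : (AdelicGroupData.gl (m + 1) ℚ).IsAutomorphicMeasure μ)
      (P : CuspidalAutomorphicRepGL (m + 1) ℚ μ) (𝔫 : Ideal (𝓞 ℚ)) (_ : 𝔫 ≠ 0),
      ∀ᶠ v : HeightOneSpectrum (𝓞 ℚ) in cofinite,
        ¬ v.asIdeal ∣ 𝔫 ∧ ∃ α β : ℂ,
          α + β = heckeEigenvalue f (Rat.HeightOneSpectrum.primesEquiv v) /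
              (((Real.sqrt (Rat.HeightOneSpectrum.primesEquiv v : ℕ) : ℝ) : ℂ) ^ (k - 1)) ∧
          α * β = nebentypus f (Rat.HeightOneSpectrum.primesEquiv v : ℕ) ∧
          ∃ ϖ : (v.adicCompletion ℚ)ˣ,
            HasSatakeParameterAt P.1 (principalCongruenceLevel (m + 1) ℚ 𝔫) v ϖ
              ((Multiset.range (m + 1)).map fun i => α ^ i * β ^ (m - i))

end SymmetricPower

end Literature.NumberTheory.Automorphic
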